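/-
Copyright (c) 2026 the pub-hodgecm-mathlib formalisation cell (harness21).  Prover seat hodgecm-mathlib-LH4-p07 (g11) (Track A «FOUR-FRAME» free hand routed by the
CHAIR VALVE to L1; LEAD F0P6-plan (g14) BATCH #108 (2) «(K1a-♮) `K2LiuKindOneSingularTermPackage`»; self-cut (K1a-4)″ posted 2026-09-04T23:26Z to line lead K2E5-p16 (g8)),
Track B «K2-LIT», #184♮ = hLiu418 = stmt-HodgeConjecture-24832.  THE K1 SCALAR OF RECORD UNDER A CHANGE OF THE EXCEPTIONAL SET — the K1 twin of ★ p861784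
`K2LiuSiegelIntertwiningScalarChangeOfSet` (KIND 0), plus the uniform bound `‖c¹_v(s)⁻¹‖ ≤ 16∕3` on `{0 < re}` and the transport of the pole-cleared continuation `G`.
-/
import Summits.HodgeConjecture.HodgeConjecture.Theorems.K2LiuKindOneSingularScalarGL1           -- ★ p862613 ((K1a-4) FILE 1): `hasProd_aK1`, `hasProd_localScalarK1`, `exists_differentiableOn_sub_half_mul_scalarK1{,_cm}`
import Summits.HodgeConjecture.HodgeConjecture.Theorems.K2LiuSiegelIntertwiningScalarChangeOfSet  -- ★ p861784 (K0 twin): `hasProd_of_hasProd_off_union_finset`, `b_eq_finsetProd_mul`, `localB_den_ne_zero`, `differentiable_natCast_cpow_neg_affine`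
import HarnessLib

/-!
# Crux `HLiu418`, socket #41 KIND 1 a♮ — (K1a-4)″ `K2LiuKindOneSingularScalarChangeOfSet`: `sc¹^S = (∏_{v∈P} c¹_v)·sc¹^{S∪P}`, `‖c¹_v⁻¹‖ ≤ 16∕3` on `{0<re}`,
# and the pole-cleared continuation moves with the set: `G^{S∪P} = (∏_{v∈P} c¹_v⁻¹)·G^S`

Cell `hodgecm-mathlib`, crux item hLiu418 = `stmt-HodgeConjecture-24832`, route `HCCMUnconditional`; squad K2 ∕ K2Liu, LEAD F0P6-plan (g14), line lead K2E5-p16 (g8).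
THEOREMS ONLY (no `def`, no instance, no notation, no named-fact hypothesis, no `sorry`, default heartbeats); lane `--supports stmt-HodgeConjecture-24832 --as helper`.

THE OBJECT.  The K1 scalar of record (★ p862613, line lead census §1) `sc¹^S(s) = ζ_F^S(2s) ∕ (ζ_F^S(2s+1)·L^S(2s+2, ε)) = ∏'_{v∉S} c¹_v(s)`, local factor
`c¹_v(s) = (1 − q_v^{−(2s+1)})(1 − ε_v q_v^{−(2s+2)}) ∕ (1 − q_v^{−2s})`, and its POLE-CLEARED CONTINUATION `G^S` (`(s − ½)·sc¹^S(s) = G^S(s)` on `½ < re s`, `G^S` holomorphic on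
`{0 < re}`, ★ `exists_differentiableOn_sub_half_mul_scalarK1`).  In the (K1a-♮) package (★ p863037 `K2LiuKindOneSingularContinuationOfFaces`) the exceptional set `T(S, h) ⊇ T₀(𝒦, f)`
MOVES with the rank-one index `S` and the translate `h` (★ G1's `T ⊇ T₀(𝒦, f, h′, S♭)`); the (L-dec) letter `hdeca` needs bounds UNIFORM in `(S, h)`.  THIS FILE is the bookkeeping:
* §1 **`aK1_eq_finsetProd_mul`** — `ζ_F^S(2s) = (∏_{v∈P} (1 − q_v^{−2s})⁻¹)·ζ_F^{S∪P}(2s)` on `½ < re s` (★ `hasProd_aK1` at `S` and `S ∪ P`, ★ `hasProd_of_hasProd_off_union_finset`,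
  `HasProd.unique`); **`scalarK1_eq_finsetProd_mul`** — `sc¹^S = (∏_{v∈P} c¹_v)·sc¹^{S∪P}` on `½ < re s` (with ★ `b_eq_finsetProd_mul` for the denominator); the inverse reading
  **`scalarK1_union_eq_finsetProd_inv_mul`** — `sc¹^{S∪P} = (∏_{v∈P} c¹_v⁻¹)·sc¹^S` (`c¹_v ≠ 0` on `{0 < re}`).
* §2 **`localAK1_ne_zero`**, **`localScalarK1_ne_zero`**, **`differentiableOn_inv_localScalarK1`** (`c¹_v⁻¹ = (1 − q^{−2s}) ∕ ((1 − q^{−(2s+1)})(1 − ε q^{−(2s+2)}))` holomorphic on `{−½ < re}`) and the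
  UNIFORM BOUND **`norm_inv_localScalarK1_le`**: `‖c¹_v(s)⁻¹‖ ≤ 16∕3` for `0 < re s`, `q_v ≥ 2`, `‖ε_v‖ ≤ 1` (numerator `≤ 2`, denominator `≥ ½ · ¾`); hence
  **`norm_finsetProd_inv_localScalarK1_le`**: `‖∏_{v∈P} c¹_v⁻¹‖ ≤ (16∕3)^{#P}`.
* §3 **`G`-TRANSPORT `sub_half_mul_scalarK1_union_eq`**: if `(s − ½)·sc¹^S = G^S` on `½ < re s` then `(s − ½)·sc¹^{S∪P} = (∏_{v∈P} c¹_v⁻¹)·G^S` there, and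
  **`differentiableOn_finsetProd_inv_localScalarK1_mul`**: `(∏_{v∈P} c¹_v⁻¹)·G^S` is holomorphic on `{0 < re}` — so ONE `G₀ := G^{T₀}` serves every `T₀ ∪ P(S,h)`, with
  `‖G^{T₀∪P}(s)‖ ≤ (16∕3)^{#P}·‖G₀(s)‖` (**`norm_transportedG_le`**).
* §4 the CM forms (`F = L⁺`, `ε = ε_{L∕L⁺} =` ★ `quadraticHeckeCharCM L`, unitary by ★ `isFiniteOrder_quadraticHeckeCharCM`).
HONEST LABEL.  Euler-product ∕ elementary-estimate bookkeeping, count-neutral; nothing here closes a socket: `HC_CM` is proved only modulo the 7 printed citations (2 remaining named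
inputs: hLiu418 = `stmt-HodgeConjecture-24832`, h413 = `stmt-HodgeConjecture-24833`) until rung 0 closes.

## References
* [Tan1999] V. Tan, *Poles of Siegel Eisenstein series on U(n,n)*, Canad. J. Math. 51 (1999) 164–175: §3 (the unramified scalars), §4 Prop. 4.8.
* [KudlaSweet1997] S. Kudla, W. J. Sweet, *Degenerate principal series representations for U(n,n)*, Israel J. Math. 98 (1997): §1 (local factors, their zeros and poles).
* [Harris2007] M. Harris, *Cohomological automorphic forms on unitary groups, II* (2007): (1.3.4) p. 92 (restricted Euler products of the local scalars).
* [HeilbronnZetaL1967] H. Heilbronn, *Zeta-functions and L-functions*, in Cassels–Fröhlich (1967): Ch. VIII §2 Thm. 5 (moving finitely many Euler factors).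
-/

set_option autoImplicit false
set_option linter.dupNamespace false -- the mandated namespace repeats `HodgeConjecture.HodgeConjecture`

noncomputable section

open scoped NNReal
open Filter Topology Complex NumberField IsDedekindDomain
open Literature.NumberTheory.Automorphic Literature.NumberTheory.LFunctions Literature.NumberTheory.GaloisRepresentations
open Summit.HodgeConjecture.HodgeConjecture.Cruxes.HLiu418.K2LiuSiegelIntertwiningScalarGL1
open Summit.HodgeConjecture.HodgeConjecture.Cruxes.HLiu418.K2LiuSiegelIntertwiningScalarChangeOfSet
open Summit.HodgeConjecture.HodgeConjecture.Cruxes.HLiu418.K2LiuKindOneSingularScalarGL1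

namespace Summit.HodgeConjecture.HodgeConjecture.Cruxes.HLiu418.K2LiuKindOneSingularScalarChangeOfSet

/-! ## §1 `ζ^S(2s)` and `sc¹^S` under `S ↦ S ∪ P` -/

section GL1

variable {F : Type} [Field F] [NumberField F] {ε : HeckeCharacter F}

/-- **`ζ_F^S(2s) = (∏_{v∈P} (1 − q_v^{−2s})⁻¹)·ζ_F^{S∪P}(2s)`** on `½ < re s` (`P` finite, disjoint from `S`): ★ `hasProd_aK1` at `S` against ★ `hasProd_of_hasProd_off_union_finset`
applied to ★ `hasProd_aK1` at `S ∪ P`. [cite: HeilbronnZetaL1967, Ch. VIII §2 Thm. 5] [cite: Tan1999, §3] -/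
theorem aK1_eq_finsetProd_mul (S : Set (HeightOneSpectrum (𝓞 F))) (P : Finset (HeightOneSpectrum (𝓞 F))) (hPS : ∀ v ∈ P, v ∉ S) {s : ℂ} (hs : 1 / 2 < s.re) :
    partialStandardL S (fun _ => {1}) (2 * s) =
      (∏ v ∈ P, (1 - (v.residueCard : ℂ) ^ (-(2 * s)))⁻¹) * partialStandardL (S ∪ (↑P : Set (HeightOneSpectrum (𝓞 F)))) (fun _ => {1}) (2 * s) :=
  (hasProd_aK1 (F := F) (S := S) hs).1.unique
    (hasProd_of_hasProd_off_union_finset S P hPS (fun v => (1 - (v.residueCard : ℂ) ^ (-(2 * s)))⁻¹)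
      (hasProd_aK1 (F := F) (S := S ∪ (↑P : Set (HeightOneSpectrum (𝓞 F)))) hs).1)

/-- per place: `a¹_v ∕ b_v = c¹_v` in ★ `hasProd_localScalarK1`'s spelling (`x⁻¹ ∕ (u⁻¹ w⁻¹) = (u w) ∕ x`, unconditionally in a field). [cite: Harris2007, (1.3.4) p. 92] -/
theorem localAK1_div_localB_eq (q e : ℂ) (s : ℂ) :
    (1 - q ^ (-(2 * s)))⁻¹ / ((1 - q ^ (-(2 * s + 1)))⁻¹ * (1 - e * q ^ (-(2 * s + 2)))⁻¹) =
      ((1 - q ^ (-(2 * s + 1))) * (1 - e * q ^ (-(2 * s + 2)))) / (1 - q ^ (-(2 * s))) := by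
  simp only [div_eq_mul_inv, mul_inv, inv_inv]
  ring

/-- **`sc¹^S(s) = (∏_{v∈P} c¹_v(s))·sc¹^{S∪P}(s)`** on `½ < re s`: the K1 scalar of record `ζ_F^S(2s) ∕ (ζ_F^S(2s+1)·L^S(2s+2, ε))` under `S ↦ S ∪ P`, with the local K1 scalar
`c¹_v(s) = (1 − q_v^{−(2s+1)})(1 − ε_v q_v^{−(2s+2)}) ∕ (1 − q_v^{−2s})` of ★ `hasProd_localScalarK1` (numerator §1, denominator ★ `b_eq_finsetProd_mul`). [cite: Tan1999, §3]
[cite: Harris2007, (1.3.4) p. 92] [cite: KudlaSweet1997, §1] -/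
theorem scalarK1_eq_finsetProd_mul (hε : ε.IsUnitary) (S : Set (HeightOneSpectrum (𝓞 F))) (P : Finset (HeightOneSpectrum (𝓞 F)))
    (hPS : ∀ v ∈ P, v ∉ S) {s : ℂ} (hs : 1 / 2 < s.re) :
    partialStandardL S (fun _ => {1}) (2 * s) /
        (partialStandardL S (fun _ => {1}) (2 * s + 1) * partialStandardL S (fun v => {ε.valueAtUniformizer v}) (2 * s + 2)) =
      (∏ v ∈ P, (((1 - (v.residueCard : ℂ) ^ (-(2 * s + 1))) * (1 - ε.valueAtUniformizer v * (v.residueCard : ℂ) ^ (-(2 * s + 2)))) /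
          (1 - (v.residueCard : ℂ) ^ (-(2 * s))))) *
        (partialStandardL (S ∪ (↑P : Set (HeightOneSpectrum (𝓞 F)))) (fun _ => {1}) (2 * s) /
          (partialStandardL (S ∪ (↑P : Set (HeightOneSpectrum (𝓞 F)))) (fun _ => {1}) (2 * s + 1) *
            partialStandardL (S ∪ (↑P : Set (HeightOneSpectrum (𝓞 F)))) (fun v => {ε.valueAtUniformizer v}) (2 * s + 2))) := by
  rw [aK1_eq_finsetProd_mul S P hPS hs, b_eq_finsetProd_mul hε S P hPS (show (0 : ℝ) < s.re by linarith), mul_div_mul_comm, ← Finset.prod_div_distrib]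
  refine congrArg₂ (· * ·) (Finset.prod_congr rfl fun v _ => localAK1_div_localB_eq _ _ s) rfl

end GL1

/-! ## §2 The local K1 scalar: non-vanishing, holomorphy of its inverse, and the uniform bound `‖c¹_v⁻¹‖ ≤ 16∕3` on `{0 < re}` -/

/-- `‖q^{−z}‖ ≤ q^{−r}` when `r ≤ re z` (`q ≥ 1`). [folklore] -/
theorem norm_natCast_cpow_neg_le_rpow {q : ℕ} (hq : 1 ≤ q) {z : ℂ} {r : ℝ} (hr : r ≤ z.re) : ‖(q : ℂ) ^ (-z)‖ ≤ (q : ℝ) ^ (-r) := by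
  have hq0 : 0 < q := lt_of_lt_of_le zero_lt_one hq
  rw [Complex.norm_natCast_cpow_of_pos hq0, Complex.neg_re]
  exact Real.rpow_le_rpow_of_exponent_le (by exact_mod_cast hq) (neg_le_neg hr)

/-- the K1 pole factor's local denominator: **`1 − q^{−2s} ≠ 0` on `{0 < re}`** (`q > 1`; `‖q^{−2s}‖ = q^{−2 re s} < 1`, cf. ★ `K2E1FiniteWhittakerInertU3.one_sub_natCast_cpow_neg_ne_zero`,
inlined at the K1 exponent to keep the import light). [folklore] -/
theorem localAK1_ne_zero {q : ℕ} (hq : 1 < q) {s : ℂ} (hs : 0 < s.re) : (1 : ℂ) - (q : ℂ) ^ (-(2 * s)) ≠ 0 := by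
  refine sub_ne_zero.2 fun h => ?_
  have h1 : ‖(q : ℂ) ^ (-(2 * s))‖ < 1 := by
    rw [Complex.norm_natCast_cpow_of_pos (lt_trans zero_lt_one hq), Complex.neg_re]
    exact Real.rpow_lt_one_of_one_lt_of_neg (by exact_mod_cast hq) (neg_lt_zero.2 (by simp [Complex.mul_re]; linarith))
  rw [← h, norm_one] at h1
  exact lt_irrefl _ h1

/-- **`c¹_v(s) ≠ 0` on `{0 < re}`**: the numerator `(1 − q^{−(2s+1)})(1 − ε q^{−(2s+2)})` does not vanish there (★ `localB_den_ne_zero`, even on `{−½ < re}`) and neither does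
`1 − q^{−2s}`. [cite: KudlaSweet1997, §1] -/
theorem localScalarK1_ne_zero {q : ℕ} (hq : 1 < q) {e : ℂ} (he : ‖e‖ ≤ 1) {s : ℂ} (hs : 0 < s.re) :
    ((1 - (q : ℂ) ^ (-(2 * s + 1))) * (1 - e * (q : ℂ) ^ (-(2 * s + 2)))) / (1 - (q : ℂ) ^ (-(2 * s))) ≠ 0 :=
  div_ne_zero (localB_den_ne_zero hq he (by linarith)) (localAK1_ne_zero hq hs)

/-- **`c¹_v⁻¹ = (1 − q^{−2s}) ∕ ((1 − q^{−(2s+1)})(1 − ε q^{−(2s+2)}))` is holomorphic on `{−½ < re}`** (`q > 1`, `‖ε_v‖ ≤ 1`; ★ `localB_den_ne_zero`). [cite: KudlaSweet1997, §1] -/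
theorem differentiableOn_inv_localScalarK1 {q : ℕ} (hq : 1 < q) {e : ℂ} (he : ‖e‖ ≤ 1) :
    DifferentiableOn ℂ (fun s : ℂ => (1 - (q : ℂ) ^ (-(2 * s))) / ((1 - (q : ℂ) ^ (-(2 * s + 1))) * (1 - e * (q : ℂ) ^ (-(2 * s + 2)))))
      {s : ℂ | -(1 / 2 : ℝ) < s.re} := by
  have hq0 : q ≠ 0 := by omega
  have hnum : Differentiable ℂ fun s : ℂ => 1 - (q : ℂ) ^ (-(2 * s)) :=
    (differentiable_const _).sub (by simpa only [add_zero] using differentiable_natCast_cpow_neg_affine hq0 0)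
  have hden : Differentiable ℂ fun s : ℂ => (1 - (q : ℂ) ^ (-(2 * s + 1))) * (1 - e * (q : ℂ) ^ (-(2 * s + 2))) :=
    ((differentiable_const _).sub (differentiable_natCast_cpow_neg_affine hq0 1)).mul
      ((differentiable_const _).sub ((differentiable_const _).mul (differentiable_natCast_cpow_neg_affine hq0 2)))
  exact hnum.differentiableOn.div hden.differentiableOn fun s hs => localB_den_ne_zero hq he hs

/-- **THE UNIFORM BOUND `‖c¹_v(s)⁻¹‖ ≤ 16∕3` on `{0 < re}`** (`q_v ≥ 2`, `‖ε_v‖ ≤ 1`): `‖1 − q^{−2s}‖ ≤ 2`, `‖1 − q^{−(2s+1)}‖ ≥ 1 − q^{−1} ≥ ½`, `‖1 − ε q^{−(2s+2)}‖ ≥ 1 − q^{−2} ≥ ¾`.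
The constant is independent of `v`, `ε` and `s` — the letter that makes the pole-cleared K1 scalar at a moving exceptional set `T₀ ∪ P(S,h)` uniformly comparable to the one at `T₀`.
[cite: KudlaSweet1997, §1] [cite: Tan1999, §3] -/
theorem norm_inv_localScalarK1_le {q : ℕ} (hq : 1 < q) {e : ℂ} (he : ‖e‖ ≤ 1) {s : ℂ} (hs : 0 < s.re) :
    ‖(1 - (q : ℂ) ^ (-(2 * s))) / ((1 - (q : ℂ) ^ (-(2 * s + 1))) * (1 - e * (q : ℂ) ^ (-(2 * s + 2))))‖ ≤ 16 / 3 := by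
  have hq1 : (1 : ℝ) ≤ q := by exact_mod_cast hq.le
  have hq2 : (2 : ℝ) ≤ q := by exact_mod_cast hq
  have hqpos : (0 : ℝ) < q := by linarith
  -- numerator ≤ 2
  have hnum : ‖1 - (q : ℂ) ^ (-(2 * s))‖ ≤ 2 := by
    have h1 : ‖(q : ℂ) ^ (-(2 * s))‖ ≤ 1 := by
      have h := norm_natCast_cpow_neg_le_rpow hq.le (z := 2 * s) (r := 0) (by simp [Complex.mul_re]; linarith)
      rwa [neg_zero, Real.rpow_zero] at h
    calc ‖1 - (q : ℂ) ^ (-(2 * s))‖ ≤ ‖(1 : ℂ)‖ + ‖(q : ℂ) ^ (-(2 * s))‖ := norm_sub_le _ _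
      _ ≤ 1 + 1 := by rw [norm_one]; exact add_le_add le_rfl h1
      _ = 2 := by norm_num
  -- first denominator factor ≥ ½
  have hd1 : (1 / 2 : ℝ) ≤ ‖1 - (q : ℂ) ^ (-(2 * s + 1))‖ := by
    have h1 : ‖(q : ℂ) ^ (-(2 * s + 1))‖ ≤ (q : ℝ) ^ (-(1 : ℝ)) :=
      norm_natCast_cpow_neg_le_rpow hq.le (by simp [Complex.add_re, Complex.mul_re]; linarith)
    have h2 : (q : ℝ) ^ (-(1 : ℝ)) ≤ 1 / 2 := by
      rw [Real.rpow_neg hqpos.le, Real.rpow_one]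
      exact inv_le_of_inv_le₀ (by norm_num) (by simpa using hq2)
    calc (1 / 2 : ℝ) = 1 - 1 / 2 := by norm_num
      _ ≤ ‖(1 : ℂ)‖ - ‖(q : ℂ) ^ (-(2 * s + 1))‖ := by rw [norm_one]; linarith
      _ ≤ ‖1 - (q : ℂ) ^ (-(2 * s + 1))‖ := norm_sub_norm_le _ _
  -- second denominator factor ≥ ¾
  have hd2 : (3 / 4 : ℝ) ≤ ‖1 - e * (q : ℂ) ^ (-(2 * s + 2))‖ := by
    have h1 : ‖(q : ℂ) ^ (-(2 * s + 2))‖ ≤ (q : ℝ) ^ (-(2 : ℝ)) :=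
      norm_natCast_cpow_neg_le_rpow hq.le (by simp [Complex.add_re, Complex.mul_re]; linarith)
    have h2 : (q : ℝ) ^ (-(2 : ℝ)) ≤ 1 / 4 := by
      rw [Real.rpow_neg hqpos.le, show (2 : ℝ) = ((2 : ℕ) : ℝ) by norm_num, Real.rpow_natCast]
      exact inv_le_of_inv_le₀ (by norm_num) (by nlinarith)
    have h3 : ‖e * (q : ℂ) ^ (-(2 * s + 2))‖ ≤ 1 / 4 := by
      rw [norm_mul]
      calc ‖e‖ * ‖(q : ℂ) ^ (-(2 * s + 2))‖ ≤ 1 * (q : ℝ) ^ (-(2 : ℝ)) := by gcongr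
        _ ≤ 1 / 4 := by rw [one_mul]; exact h2
    calc (3 / 4 : ℝ) = 1 - 1 / 4 := by norm_num
      _ ≤ ‖(1 : ℂ)‖ - ‖e * (q : ℂ) ^ (-(2 * s + 2))‖ := by rw [norm_one]; linarith
      _ ≤ ‖1 - e * (q : ℂ) ^ (-(2 * s + 2))‖ := norm_sub_norm_le _ _
  have hden : (3 / 8 : ℝ) ≤ ‖(1 - (q : ℂ) ^ (-(2 * s + 1))) * (1 - e * (q : ℂ) ^ (-(2 * s + 2)))‖ := by
    rw [norm_mul]
    calc (3 / 8 : ℝ) = 1 / 2 * (3 / 4) := by norm_num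
      _ ≤ _ := mul_le_mul hd1 hd2 (by norm_num) (le_trans (by norm_num) hd1)
  have hden0 : (0 : ℝ) < ‖(1 - (q : ℂ) ^ (-(2 * s + 1))) * (1 - e * (q : ℂ) ^ (-(2 * s + 2)))‖ := lt_of_lt_of_le (by norm_num) hden
  rw [norm_div, div_le_iff₀ hden0]
  calc ‖1 - (q : ℂ) ^ (-(2 * s))‖ ≤ 2 := hnum
    _ = 16 / 3 * (3 / 8) := by norm_num
    _ ≤ 16 / 3 * ‖(1 - (q : ℂ) ^ (-(2 * s + 1))) * (1 - e * (q : ℂ) ^ (-(2 * s + 2)))‖ := by gcongr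

section GL1'

variable {F : Type} [Field F] [NumberField F] {ε : HeckeCharacter F}

/-- **`∏_{v∈P} c¹_v⁻¹` is holomorphic on `{−½ < re}`** (and a fortiori on `{0 < re}`) for a unitary `ε`. [cite: KudlaSweet1997, §1] -/
theorem differentiableOn_finsetProd_inv_localScalarK1 (hε : ε.IsUnitary) (P : Finset (HeightOneSpectrum (𝓞 F))) :
    DifferentiableOn ℂ (fun s : ℂ => ∏ v ∈ P, ((1 - (v.residueCard : ℂ) ^ (-(2 * s))) /
        ((1 - (v.residueCard : ℂ) ^ (-(2 * s + 1))) * (1 - ε.valueAtUniformizer v * (v.residueCard : ℂ) ^ (-(2 * s + 2))))))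
      {s : ℂ | -(1 / 2 : ℝ) < s.re} :=
  DifferentiableOn.fun_finsetProd fun v _ =>
    differentiableOn_inv_localScalarK1 v.one_lt_residueCard (HeckeCharacter.norm_valueAtUniformizer_of_isUnitary hε v).le

/-- **`‖∏_{v∈P} c¹_v(s)⁻¹‖ ≤ (16∕3)^{#P}`** on `{0 < re}` for a unitary `ε`. [cite: KudlaSweet1997, §1] [cite: Tan1999, §3] -/
theorem norm_finsetProd_inv_localScalarK1_le (hε : ε.IsUnitary) (P : Finset (HeightOneSpectrum (𝓞 F))) {s : ℂ} (hs : 0 < s.re) :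
    ‖∏ v ∈ P, ((1 - (v.residueCard : ℂ) ^ (-(2 * s))) /
        ((1 - (v.residueCard : ℂ) ^ (-(2 * s + 1))) * (1 - ε.valueAtUniformizer v * (v.residueCard : ℂ) ^ (-(2 * s + 2)))))‖ ≤
      (16 / 3 : ℝ) ^ P.card := by
  rw [norm_prod, ← Finset.prod_const]
  exact Finset.prod_le_prod (fun v _ => norm_nonneg _) fun v _ =>
    norm_inv_localScalarK1_le v.one_lt_residueCard (HeckeCharacter.norm_valueAtUniformizer_of_isUnitary hε v).le hs

/-- **THE INVERSE READING `sc¹^{S∪P}(s) = (∏_{v∈P} c¹_v(s)⁻¹)·sc¹^S(s)`** on `½ < re s` (each `c¹_v ≠ 0` there). [cite: Tan1999, §3] [cite: Harris2007, (1.3.4) p. 92] -/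
theorem scalarK1_union_eq_finsetProd_inv_mul (hε : ε.IsUnitary) (S : Set (HeightOneSpectrum (𝓞 F))) (P : Finset (HeightOneSpectrum (𝓞 F)))
    (hPS : ∀ v ∈ P, v ∉ S) {s : ℂ} (hs : 1 / 2 < s.re) :
    partialStandardL (S ∪ (↑P : Set (HeightOneSpectrum (𝓞 F)))) (fun _ => {1}) (2 * s) /
        (partialStandardL (S ∪ (↑P : Set (HeightOneSpectrum (𝓞 F)))) (fun _ => {1}) (2 * s + 1) *
          partialStandardL (S ∪ (↑P : Set (HeightOneSpectrum (𝓞 F)))) (fun v => {ε.valueAtUniformizer v}) (2 * s + 2)) =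
      (∏ v ∈ P, ((1 - (v.residueCard : ℂ) ^ (-(2 * s))) /
          ((1 - (v.residueCard : ℂ) ^ (-(2 * s + 1))) * (1 - ε.valueAtUniformizer v * (v.residueCard : ℂ) ^ (-(2 * s + 2)))))) *
        (partialStandardL S (fun _ => {1}) (2 * s) /
          (partialStandardL S (fun _ => {1}) (2 * s + 1) * partialStandardL S (fun v => {ε.valueAtUniformizer v}) (2 * s + 2))) := by
  rw [scalarK1_eq_finsetProd_mul hε S P hPS hs, ← mul_assoc, ← Finset.prod_mul_distrib, Finset.prod_eq_one fun v _ => ?_, one_mul]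
  have hn : (1 : ℂ) - (v.residueCard : ℂ) ^ (-(2 * s)) ≠ 0 := localAK1_ne_zero v.one_lt_residueCard (by linarith)
  have hd : (1 - (v.residueCard : ℂ) ^ (-(2 * s + 1))) * (1 - ε.valueAtUniformizer v * (v.residueCard : ℂ) ^ (-(2 * s + 2))) ≠ 0 :=
    localB_den_ne_zero v.one_lt_residueCard (HeckeCharacter.norm_valueAtUniformizer_of_isUnitary hε v).le (by linarith)
  rw [div_mul_div_comm, div_eq_one_iff_eq (mul_ne_zero hd hn), mul_comm]

/-! ## §3 Transport of the pole-cleared continuation `G` -/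

/-- **`G`-TRANSPORT.**  If `(s − ½)·sc¹^S(s) = G s` on `½ < re s` (★ `exists_differentiableOn_sub_half_mul_scalarK1`), then for every finite `P` disjoint from `S`
`(s − ½)·sc¹^{S∪P}(s) = (∏_{v∈P} c¹_v(s)⁻¹)·G s` on `½ < re s` — the SAME `G`, corrected by the finite holomorphic product (§2). [cite: Tan1999, §3; §4 Prop. 4.8] -/
theorem sub_half_mul_scalarK1_union_eq (hε : ε.IsUnitary) (S : Set (HeightOneSpectrum (𝓞 F))) (P : Finset (HeightOneSpectrum (𝓞 F)))
    (hPS : ∀ v ∈ P, v ∉ S) {G : ℂ → ℂ}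
    (hG : ∀ s : ℂ, 1 / 2 < s.re → (s - 1 / 2) *
      (partialStandardL S (fun _ => {1}) (2 * s) /
        (partialStandardL S (fun _ => {1}) (2 * s + 1) * partialStandardL S (fun v => {ε.valueAtUniformizer v}) (2 * s + 2))) = G s)
    {s : ℂ} (hs : 1 / 2 < s.re) :
    (s - 1 / 2) *
        (partialStandardL (S ∪ (↑P : Set (HeightOneSpectrum (𝓞 F)))) (fun _ => {1}) (2 * s) /
          (partialStandardL (S ∪ (↑P : Set (HeightOneSpectrum (𝓞 F)))) (fun _ => {1}) (2 * s + 1) *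
            partialStandardL (S ∪ (↑P : Set (HeightOneSpectrum (𝓞 F)))) (fun v => {ε.valueAtUniformizer v}) (2 * s + 2))) =
      (∏ v ∈ P, ((1 - (v.residueCard : ℂ) ^ (-(2 * s))) /
          ((1 - (v.residueCard : ℂ) ^ (-(2 * s + 1))) * (1 - ε.valueAtUniformizer v * (v.residueCard : ℂ) ^ (-(2 * s + 2)))))) * G s := by
  rw [scalarK1_union_eq_finsetProd_inv_mul hε S P hPS hs, ← hG s hs]
  ring

/-- **The transported continuation is holomorphic on `{0 < re}`**: `s ↦ (∏_{v∈P} c¹_v(s)⁻¹)·G s`. [cite: KudlaSweet1997, §1] -/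
theorem differentiableOn_finsetProd_inv_localScalarK1_mul (hε : ε.IsUnitary) (P : Finset (HeightOneSpectrum (𝓞 F))) {G : ℂ → ℂ}
    (hG : DifferentiableOn ℂ G {s : ℂ | 0 < s.re}) :
    DifferentiableOn ℂ (fun s : ℂ => (∏ v ∈ P, ((1 - (v.residueCard : ℂ) ^ (-(2 * s))) /
        ((1 - (v.residueCard : ℂ) ^ (-(2 * s + 1))) * (1 - ε.valueAtUniformizer v * (v.residueCard : ℂ) ^ (-(2 * s + 2)))))) * G s)
      {s : ℂ | 0 < s.re} :=
  ((differentiableOn_finsetProd_inv_localScalarK1 hε P).mono fun s (hs : 0 < s.re) => show -(1 / 2 : ℝ) < s.re by linarith).mul hG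

/-- **The transported continuation is uniformly comparable to `G`**: `‖(∏_{v∈P} c¹_v(s)⁻¹)·G s‖ ≤ (16∕3)^{#P}·‖G s‖` on `{0 < re}`. [cite: KudlaSweet1997, §1] [cite: Tan1999, §3] -/
theorem norm_transportedG_le (hε : ε.IsUnitary) (P : Finset (HeightOneSpectrum (𝓞 F))) (G : ℂ → ℂ) {s : ℂ} (hs : 0 < s.re) :
    ‖(∏ v ∈ P, ((1 - (v.residueCard : ℂ) ^ (-(2 * s))) /
        ((1 - (v.residueCard : ℂ) ^ (-(2 * s + 1))) * (1 - ε.valueAtUniformizer v * (v.residueCard : ℂ) ^ (-(2 * s + 2)))))) * G s‖ ≤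
      (16 / 3 : ℝ) ^ P.card * ‖G s‖ := by
  rw [norm_mul]
  exact mul_le_mul_of_nonneg_right (norm_finsetProd_inv_localScalarK1_le hε P hs) (norm_nonneg _)

/-- **ONE `G₀` SERVES EVERY LARGER SET**: from ★ FILE 1 at `S`, for every finite `P` disjoint from `S` there is a pole-cleared continuation of `sc¹^{S∪P}` on `{0 < re}` of the form
`(∏_{v∈P} c¹_v⁻¹)·G₀`, bounded by `(16∕3)^{#P}·‖G₀‖`. [cite: Tan1999, §3; §4 Prop. 4.8] [cite: KudlaSweet1997, §1] -/
theorem exists_G_forall_union (hε : ε.IsUnitary) {S : Set (HeightOneSpectrum (𝓞 F))} (hS : S.Finite) :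
    ∃ G₀ : ℂ → ℂ, DifferentiableOn ℂ G₀ {s : ℂ | 0 < s.re} ∧
      (∀ s : ℂ, 1 / 2 < s.re → (s - 1 / 2) *
        (partialStandardL S (fun _ => {1}) (2 * s) /
          (partialStandardL S (fun _ => {1}) (2 * s + 1) * partialStandardL S (fun v => {ε.valueAtUniformizer v}) (2 * s + 2))) = G₀ s) ∧
      ∀ P : Finset (HeightOneSpectrum (𝓞 F)), (∀ v ∈ P, v ∉ S) →
        DifferentiableOn ℂ (fun s : ℂ => (∏ v ∈ P, ((1 - (v.residueCard : ℂ) ^ (-(2 * s))) /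
            ((1 - (v.residueCard : ℂ) ^ (-(2 * s + 1))) * (1 - ε.valueAtUniformizer v * (v.residueCard : ℂ) ^ (-(2 * s + 2)))))) * G₀ s)
          {s : ℂ | 0 < s.re} ∧
        (∀ s : ℂ, 1 / 2 < s.re → (s - 1 / 2) *
          (partialStandardL (S ∪ (↑P : Set (HeightOneSpectrum (𝓞 F)))) (fun _ => {1}) (2 * s) /
            (partialStandardL (S ∪ (↑P : Set (HeightOneSpectrum (𝓞 F)))) (fun _ => {1}) (2 * s + 1) *
              partialStandardL (S ∪ (↑P : Set (HeightOneSpectrum (𝓞 F)))) (fun v => {ε.valueAtUniformizer v}) (2 * s + 2))) =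
          (∏ v ∈ P, ((1 - (v.residueCard : ℂ) ^ (-(2 * s))) /
              ((1 - (v.residueCard : ℂ) ^ (-(2 * s + 1))) * (1 - ε.valueAtUniformizer v * (v.residueCard : ℂ) ^ (-(2 * s + 2)))))) * G₀ s) ∧
        (∀ s : ℂ, 0 < s.re → ‖(∏ v ∈ P, ((1 - (v.residueCard : ℂ) ^ (-(2 * s))) /
            ((1 - (v.residueCard : ℂ) ^ (-(2 * s + 1))) * (1 - ε.valueAtUniformizer v * (v.residueCard : ℂ) ^ (-(2 * s + 2)))))) * G₀ s‖ ≤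
          (16 / 3 : ℝ) ^ P.card * ‖G₀ s‖) := by
  obtain ⟨G₀, hG₀, hsc⟩ := exists_differentiableOn_sub_half_mul_scalarK1 (S := S) hε hS
  exact ⟨G₀, hG₀, hsc, fun P hPS => ⟨differentiableOn_finsetProd_inv_localScalarK1_mul hε P hG₀,
    fun s hs => sub_half_mul_scalarK1_union_eq hε S P hPS hsc hs, fun s hs => norm_transportedG_le hε P G₀ hs⟩⟩

end GL1'

/-! ## §4 The CM forms: `F = L⁺`, `ε = ε_{L∕L⁺}` -/

section CM

variable (L : Type) [Field L] [NumberField L] [IsCMField L]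

/-- **AT THE K2_Liu FRAME**: `sc¹^{T∪P} = (∏_{v∈P} c¹_v⁻¹)·sc¹^T` on `½ < re s` (`ε = ε_{L∕L⁺}`). [cite: Tan1999, §3] [cite: Harris2007, (1.3.4) p. 92] -/
theorem scalarK1_union_eq_finsetProd_inv_mul_cm (T : Set (HeightOneSpectrum (𝓞 ↥(maximalRealSubfield L))))
    (P : Finset (HeightOneSpectrum (𝓞 ↥(maximalRealSubfield L)))) (hPT : ∀ v ∈ P, v ∉ T) {s : ℂ} (hs : 1 / 2 < s.re) :
    partialStandardL (T ∪ (↑P : Set (HeightOneSpectrum (𝓞 ↥(maximalRealSubfield L))))) (fun _ => {1}) (2 * s) /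
        (partialStandardL (T ∪ (↑P : Set (HeightOneSpectrum (𝓞 ↥(maximalRealSubfield L))))) (fun _ => {1}) (2 * s + 1) *
          partialStandardL (T ∪ (↑P : Set (HeightOneSpectrum (𝓞 ↥(maximalRealSubfield L))))) (fun v => {(quadraticHeckeCharCM L).valueAtUniformizer v}) (2 * s + 2)) =
      (∏ v ∈ P, ((1 - (v.residueCard : ℂ) ^ (-(2 * s))) /
          ((1 - (v.residueCard : ℂ) ^ (-(2 * s + 1))) * (1 - (quadraticHeckeCharCM L).valueAtUniformizer v * (v.residueCard : ℂ) ^ (-(2 * s + 2)))))) *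
        (partialStandardL T (fun _ => {1}) (2 * s) /
          (partialStandardL T (fun _ => {1}) (2 * s + 1) *
            partialStandardL T (fun v => {(quadraticHeckeCharCM L).valueAtUniformizer v}) (2 * s + 2))) :=
  scalarK1_union_eq_finsetProd_inv_mul (Literature.RepresentationTheory.HarrisKudlaSweet1996.isFiniteOrder_quadraticHeckeCharCM (L := L)).isUnitary T P hPT hs

/-- **AT THE K2_Liu FRAME**: `‖∏_{v∈P} c¹_v(s)⁻¹‖ ≤ (16∕3)^{#P}` on `{0 < re}`. [cite: KudlaSweet1997, §1] -/
theorem norm_finsetProd_inv_localScalarK1_le_cm (P : Finset (HeightOneSpectrum (𝓞 ↥(maximalRealSubfield L)))) {s : ℂ} (hs : 0 < s.re) :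
    ‖∏ v ∈ P, ((1 - (v.residueCard : ℂ) ^ (-(2 * s))) /
        ((1 - (v.residueCard : ℂ) ^ (-(2 * s + 1))) * (1 - (quadraticHeckeCharCM L).valueAtUniformizer v * (v.residueCard : ℂ) ^ (-(2 * s + 2)))))‖ ≤
      (16 / 3 : ℝ) ^ P.card :=
  norm_finsetProd_inv_localScalarK1_le (Literature.RepresentationTheory.HarrisKudlaSweet1996.isFiniteOrder_quadraticHeckeCharCM (L := L)).isUnitary P hs

/-- **AT THE K2_Liu FRAME — ONE `G₀` SERVES EVERY LARGER SET**: §3 `exists_G_forall_union` for `ε = ε_{L∕L⁺}` and a finite `T`. [cite: Tan1999, §3; §4 Prop. 4.8] -/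
theorem exists_G_forall_union_cm {T : Set (HeightOneSpectrum (𝓞 ↥(maximalRealSubfield L)))} (hT : T.Finite) :
    ∃ G₀ : ℂ → ℂ, DifferentiableOn ℂ G₀ {s : ℂ | 0 < s.re} ∧
      (∀ s : ℂ, 1 / 2 < s.re → (s - 1 / 2) *
        (partialStandardL T (fun _ => {1}) (2 * s) /
          (partialStandardL T (fun _ => {1}) (2 * s + 1) * partialStandardL T (fun v => {(quadraticHeckeCharCM L).valueAtUniformizer v}) (2 * s + 2))) = G₀ s) ∧
      ∀ P : Finset (HeightOneSpectrum (𝓞 ↥(maximalRealSubfield L))), (∀ v ∈ P, v ∉ T) →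
        DifferentiableOn ℂ (fun s : ℂ => (∏ v ∈ P, ((1 - (v.residueCard : ℂ) ^ (-(2 * s))) /
            ((1 - (v.residueCard : ℂ) ^ (-(2 * s + 1))) * (1 - (quadraticHeckeCharCM L).valueAtUniformizer v * (v.residueCard : ℂ) ^ (-(2 * s + 2)))))) * G₀ s)
          {s : ℂ | 0 < s.re} ∧
        (∀ s : ℂ, 1 / 2 < s.re → (s - 1 / 2) *
          (partialStandardL (T ∪ (↑P : Set (HeightOneSpectrum (𝓞 ↥(maximalRealSubfield L))))) (fun _ => {1}) (2 * s) /
            (partialStandardL (T ∪ (↑P : Set (HeightOneSpectrum (𝓞 ↥(maximalRealSubfield L))))) (fun _ => {1}) (2 * s + 1) *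
              partialStandardL (T ∪ (↑P : Set (HeightOneSpectrum (𝓞 ↥(maximalRealSubfield L))))) (fun v => {(quadraticHeckeCharCM L).valueAtUniformizer v}) (2 * s + 2))) =
          (∏ v ∈ P, ((1 - (v.residueCard : ℂ) ^ (-(2 * s))) /
              ((1 - (v.residueCard : ℂ) ^ (-(2 * s + 1))) * (1 - (quadraticHeckeCharCM L).valueAtUniformizer v * (v.residueCard : ℂ) ^ (-(2 * s + 2)))))) * G₀ s) ∧
        (∀ s : ℂ, 0 < s.re → ‖(∏ v ∈ P, ((1 - (v.residueCard : ℂ) ^ (-(2 * s))) /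
            ((1 - (v.residueCard : ℂ) ^ (-(2 * s + 1))) * (1 - (quadraticHeckeCharCM L).valueAtUniformizer v * (v.residueCard : ℂ) ^ (-(2 * s + 2)))))) * G₀ s‖ ≤
          (16 / 3 : ℝ) ^ P.card * ‖G₀ s‖) :=
  exists_G_forall_union (Literature.RepresentationTheory.HarrisKudlaSweet1996.isFiniteOrder_quadraticHeckeCharCM (L := L)).isUnitary hT

end CM

end Summit.HodgeConjecture.HodgeConjecture.Cruxes.HLiu418.K2LiuKindOneSingularScalarChangeOfSet

end
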